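import Literature.Probability.NegativeDependence.DeterminantalComplement
import HarnessLib

/-!
# Conditional (Palm) kernels of determinantal measures
# (Shirai–Takahashi 2003, Thm. 6.5; Lyons 2003, Prop. 6.3 and Prop. 8.3; Bufetov–Qiu–Shamov 2016)

T. Shirai, Y. Takahashi, *Random point fields associated with certain Fredholm determinants I*, J. Funct. Anal.
205 (2003) 414–463 (held `paper:doi-10-1016-s0022-1236-03-00171-x`), §6.2, verbatim (p. 451):

> As is mentioned in the introduction, the class of fermion processes is closed under the operation of taking
> Palm measures. **Theorem 6.5.** If `μ_{1,K}` is the fermion process associated with operator `K` and if we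
> denote its intensity by `λ₁`, then for `λ₁`-almost every `x₀` the Palm measure `μ^{x₀}_{1,K}` coincides with
> the fermion process associated with the operator `K^{x₀}` defined by
> `K^{x₀}(x, y) = (1 / K(x₀, x₀)) det [K(x, y), K(x, x₀); K(x₀, y), K(x₀, x₀)]` (6.14)
> whenever `K(x₀, x₀) > 0`.

R. Lyons, *Determinantal probability measures*, Publ. Math. IHÉS 98 (2003) (held `paper:arxiv-math_0204325`),
verbatim:

> **Proposition 6.3.** Let `E` be finite and `H` be a subspace of `ℓ²(E)`. For any `e ∈ E` with
> `0 < P^H[e ∈ 𝔅] < 1`, we have `P^H(· | e ∈ 𝔅) = P^{(H ∩ e^⊥) + [e]}(·)` and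
> `P^H(· | e ∉ 𝔅) = P^{(H + [e]) ∩ e^⊥}(·)`. […]
> **Proposition 8.3.** Let `Q` be a positive contraction on `ℓ²(E)` and `A ⊂ E`. When `𝔖` has law `P^Q`
> conditioned on `A ⊆ 𝔖`, then the law of `𝔖 ∩ (E ∖ A)` is the determinantal probability measure
> corresponding to the positive contraction on `ℓ²(E ∖ A)` whose `(e, f)`-matrix entry is
> `(P^⊥_{[A]_Q} e, P^⊥_{[A]_Q} f)_Q` [`(u, v)_Q := (Qu, v)`]. An equivalent expression was found independently by
> Shirai and Takahashi (2002), Corollary 6.5.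

A. I. Bufetov, Y. Qiu, A. Shamov, *Kernels of conditional determinantal measures and the proof of the
Lyons–Peres conjecture*, arXiv:1612.06751 (held), §2, verbatim:

> Let `B ⊂ E` be a bounded Borel subset. If `P_K(Conf(B^c)) > 0`, then […] `P̄_K|_{Conf(B^c)}` [the law
> conditioned on no particles in `B`] is a determinantal point process on `B^c` induced by the correlation kernel
> `χ_{B^c} K (1 - χ_B K)⁻¹ χ_{B^c}`; in the discrete setting, see also Borodin and Rains, Lyons.

## Transposition (finite ground set `σ`, arbitrary kernel `K ∈ M_σ(ℂ)`)

With the tree's `IsDeterminantal μ K` (`Σ_{T ⊇ S} μ(T) = det K[S]`).  For a finite set `A` of conditioning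
points with `K[A]` invertible (`P[A ⊆ X] = det K[A] ≠ 0`), the Gram entries `(P^⊥_{[A]} e, P^⊥_{[A]} f)_Q` of
Prop. 8.3 are the entries of the **Schur complement** `L := K - K[·, A] K[A]⁻¹ K[A, ·]` (for `A = {x₀}`:
`K(x,y) - K(x,x₀) K(x₀,y)/K(x₀,x₀)`, the expansion of (6.14)).  As a `σ × σ` matrix, `L` has vanishing rows and
columns on `A` (§1); the law of `X` conditioned on `A ⊆ X`, as a measure on `2^σ`, is determinantal with
kernel `L + 1_A` (the conditioning points are present a.s.), and its trace on `σ ∖ A` — the tree's `projectOn` —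
has kernel `L` (Prop. 8.3 verbatim).  The key identity is Schur's determinant formula in `Finset` form,
`det K[A ∪ S] = det K[A] · det L[S]` for `A ∩ S = ∅` (§2), proved on `σ × σ` matrices with unit rows off the
index sets (Mathlib's `det_piecewise_one_eq_submatrix_det`, `twoBlockTriangular_det`, `det_one_sub_mul_comm`).
Conditioning on `A ∩ X = ∅` is obtained from the case `A ⊆ X` for the complementary process (kernel `I - K`,
the tree's `IsDeterminantal.compl`): kernel `I - (I - K)^{A}`, whose entries off `A` are
`K + K[·, A](I - K[A])⁻¹K[A, ·]` — the discrete `χ_{B^c} K (1 - χ_B K)⁻¹ χ_{B^c}` (§4).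

## Contents (all PROVED; no definition, no named fact)

* §1 `schur_apply_eq_zero_of_mem_left`, `schur_apply_eq_zero_of_mem_right`.
* §2 **`det_submatrix_union_eq_mul_det_schur`** (Schur's formula, `Finset`-indexed principal minors).
* §3 **`IsDeterminantal.condIn`** (conditioning on `A ⊆ X`: kernel `L + 1_A`; Lyons Prop. 8.3 / (6.5)),
  **`IsDeterminantal.projectOn_compl_condIn`** (Prop. 8.3 verbatim: the law of `X ∩ (σ ∖ A)` has kernel `L`),
  **`IsDeterminantal.palm`** (Shirai–Takahashi Thm. 6.5: `K^{x₀}(x,y) = K(x,y) - K(x,x₀)K(x₀,y)/K(x₀,x₀)`).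
* §4 **`IsDeterminantal.condOut`** (conditioning on `A ∩ X = ∅`, kernel `I - (I - K)^A`),
  `condOut_kernel_apply` (its entries off `A`: `K + K[·,A](I - K[A])⁻¹K[A,·]`, Bufetov–Qiu–Shamov / Borodin–Rains),
  `IsDeterminantal.palm_out` (`A = {x₀}`: `K(x,y) + K(x,x₀)K(x₀,y)/(1 - K(x₀,x₀))`, Lyons Prop. 6.3, second display).

## References

* [ShiraiTakahashi2003] T. Shirai, Y. Takahashi, J. Funct. Anal. 205 (2003) 414–463 — Thm. 6.5, (6.14).
* [Lyons2003] R. Lyons, Publ. Math. IHÉS 98 (2003) 167–212 — Prop. 6.3, (6.5), Prop. 8.3.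
* [BufetovQiuShamov2016] A. I. Bufetov, Y. Qiu, A. Shamov, arXiv:1612.06751 — §2 (kernel of the measure
  conditioned on `Conf(B^c)`).
-/

noncomputable section

open Finset Matrix

namespace Literature.Probability.NegativeDependence

variable {σ : Type*} [Fintype σ] [DecidableEq σ]

/-! ## §1 The Schur complement `L = K - K[·,A] K[A]⁻¹ K[A,·]` vanishes on the rows and columns of `A` -/

section Schur

variable {R : Type*} [CommRing R] (K : Matrix σ σ R) (A : Finset σ)

omit [Fintype σ] in
/-- Rows of `L = K - K[·,A] K[A]⁻¹ K[A,·]` indexed by `A` vanish (`K[A,·] - K[A] K[A]⁻¹ K[A,·] = 0`).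
[cite: Lyons2003, §8 Prop. 8.3 (the projection `P^⊥_{[A]_Q}` kills `[A]`)] -/
theorem schur_apply_eq_zero_of_mem_left (hA : IsUnit (K.submatrix (Subtype.val : A → σ) (Subtype.val : A → σ)).det)
    {i : σ} (hi : i ∈ A) (j : σ) :
    (K - K.submatrix id (Subtype.val : A → σ) * (K.submatrix (Subtype.val : A → σ) (Subtype.val : A → σ))⁻¹ *
      K.submatrix (Subtype.val : A → σ) id : Matrix σ σ R) i j = 0 := by
  set KA := K.submatrix (Subtype.val : A → σ) (Subtype.val : A → σ) with hKA
  have hrow : ∀ b : A, (K.submatrix id (Subtype.val : A → σ) * KA⁻¹) i b = (1 : Matrix A A R) ⟨i, hi⟩ b := by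
    intro b
    rw [← Matrix.mul_nonsing_inv KA hA, Matrix.mul_apply, Matrix.mul_apply]
    rfl
  rw [Matrix.sub_apply, Matrix.mul_apply, sub_eq_zero]
  simp_rw [hrow, Matrix.one_apply, submatrix_apply, id_eq, ite_mul, one_mul, zero_mul]
  rw [Finset.sum_ite_eq]
  simp

omit [Fintype σ] in
/-- Columns of `L = K - K[·,A] K[A]⁻¹ K[A,·]` indexed by `A` vanish. [cite: Lyons2003, §8 Prop. 8.3] -/
theorem schur_apply_eq_zero_of_mem_right (hA : IsUnit (K.submatrix (Subtype.val : A → σ) (Subtype.val : A → σ)).det)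
    (i : σ) {j : σ} (hj : j ∈ A) :
    (K - K.submatrix id (Subtype.val : A → σ) * (K.submatrix (Subtype.val : A → σ) (Subtype.val : A → σ))⁻¹ *
      K.submatrix (Subtype.val : A → σ) id : Matrix σ σ R) i j = 0 := by
  set KA := K.submatrix (Subtype.val : A → σ) (Subtype.val : A → σ) with hKA
  have hcol : ∀ a : A, (KA⁻¹ * K.submatrix (Subtype.val : A → σ) id) a j = (1 : Matrix A A R) a ⟨j, hj⟩ := by
    intro a
    rw [← Matrix.nonsing_inv_mul KA hA, Matrix.mul_apply, Matrix.mul_apply]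
    rfl
  rw [Matrix.sub_apply, Matrix.mul_assoc, Matrix.mul_apply, sub_eq_zero]
  simp_rw [hcol, Matrix.one_apply, submatrix_apply, id_eq, mul_ite, mul_one, mul_zero]
  rw [Finset.sum_ite_eq']
  simp

/-! ## §2 Schur's determinant formula for `Finset`-indexed principal minors -/

/-- **Schur's formula**: if `K[A]` is invertible and `A ∩ S = ∅`, then
`det K[A ∪ S] = det K[A] · det L[S]`, `L = K - K[·,A] K[A]⁻¹ K[A,·]` (row operations subtracting
`K[S,A]K[A]⁻¹ ×` the `A`-rows, performed on the `σ × σ` matrix with unit rows off `A ∪ S`, then block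
triangularity). [cite: Lyons2003, §8 Prop. 8.3 (proof: `P[B ⊆ 𝔖 | A ⊆ 𝔖] = ‖⋀_{e∈B} P^⊥_{[A]_Q} e ∧ θ_A‖²_Q / ‖θ_A‖²_Q`);
ShiraiTakahashi2003, Thm. 6.5] -/
theorem det_submatrix_union_eq_mul_det_schur {S : Finset σ} (hAS : Disjoint A S)
    (hA : IsUnit (K.submatrix (Subtype.val : A → σ) (Subtype.val : A → σ)).det) :
    (K.submatrix (Subtype.val : ↥(A ∪ S) → σ) (Subtype.val : ↥(A ∪ S) → σ)).det =
      (K.submatrix (Subtype.val : A → σ) (Subtype.val : A → σ)).det *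
        ((K - K.submatrix id (Subtype.val : A → σ) * (K.submatrix (Subtype.val : A → σ) (Subtype.val : A → σ))⁻¹ *
          K.submatrix (Subtype.val : A → σ) id).submatrix (Subtype.val : S → σ) (Subtype.val : S → σ)).det := by
  set KA := K.submatrix (Subtype.val : A → σ) (Subtype.val : A → σ) with hKA
  set C := K.submatrix id (Subtype.val : A → σ) with hC
  set Rm := K.submatrix (Subtype.val : A → σ) id with hRm
  set L := K - C * KA⁻¹ * Rm with hL
  have hcolL : ∀ i, ∀ j ∈ A, L i j = 0 := fun i j hj => schur_apply_eq_zero_of_mem_right K A hA i hj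
  -- the `σ × σ` matrix with the rows of `K` on `A ∪ S` and unit rows elsewhere
  set N : Matrix σ σ R := Matrix.of ((A ∪ S).piecewise K.row (1 : Matrix σ σ R).row) with hN
  have hNA : ∀ i ∈ A ∪ S, ∀ j, N i j = K i j := by
    intro i hi j
    simp only [hN, of_apply, Finset.piecewise, Matrix.row]
    rw [if_pos hi]
  have hNo : ∀ i, i ∉ A ∪ S → ∀ j, N i j = (1 : Matrix σ σ R) i j := by
    intro i hi j
    simp only [hN, of_apply, Finset.piecewise, Matrix.row]
    rw [if_neg hi]
  have h1 : N.det = (K.submatrix (Subtype.val : ↥(A ∪ S) → σ) (Subtype.val : ↥(A ∪ S) → σ)).det :=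
    Matrix.det_piecewise_one_eq_submatrix_det K (A ∪ S)
  -- the row operation `E = 1 - 1_S K[·,A] K[A]⁻¹ Sel_A`, of determinant one
  set Sel : Matrix A σ R := (1 : Matrix σ σ R).submatrix (Subtype.val : A → σ) id with hSel
  set D : Matrix σ σ R := diagonal (fun i => if i ∈ S then (1 : R) else 0) with hD
  set E : Matrix σ σ R := 1 - D * (C * KA⁻¹) * Sel with hE
  have h2 : E.det = 1 := by
    have hSD : Sel * D = 0 := by
      ext a k
      rw [hD, Matrix.mul_diagonal, hSel, submatrix_apply, id_eq, Matrix.one_apply, Matrix.zero_apply]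
      by_cases hk : k ∈ S
      · have hak : (a : σ) ≠ k := fun h => Finset.disjoint_left.1 hAS a.2 (h ▸ hk)
        rw [if_neg hak, zero_mul]
      · rw [if_neg hk, mul_zero]
    rw [hE, Matrix.det_one_sub_mul_comm, ← Matrix.mul_assoc, hSD, Matrix.zero_mul, sub_zero, det_one]
  have hSelN : Sel * N = Rm := by
    ext a j
    rw [Matrix.mul_apply]
    simp only [hSel, submatrix_apply, id_eq, Matrix.one_apply, ite_mul, one_mul, zero_mul, Finset.sum_ite_eq,
      Finset.mem_univ, if_true]
    rw [hNA _ (Finset.mem_union_left S a.2), hRm, submatrix_apply, id_eq]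
  -- `E N` has the rows of `L` on `S`, those of `N` elsewhere
  set N' : Matrix σ σ R := Matrix.of fun i j => if i ∈ S then L i j else N i j with hN'
  have h3 : E * N = N' := by
    rw [hE, Matrix.sub_mul, Matrix.one_mul, Matrix.mul_assoc (D * (C * KA⁻¹)) Sel N, hSelN]
    ext i j
    rw [Matrix.sub_apply, hN', of_apply, Matrix.mul_assoc, hD, diagonal_mul]
    by_cases hi : i ∈ S
    · rw [if_pos hi, if_pos hi, one_mul, hL, Matrix.sub_apply, hNA i (Finset.mem_union_right A hi) j]
    · rw [if_neg hi, if_neg hi, zero_mul, sub_zero]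
  -- `N'` is block triangular with respect to `A`; its `A`-block is `K[A]`
  have hN'tri : ∀ i, ¬ i ∈ A → ∀ j, j ∈ A → N' i j = 0 := by
    intro i hi j hj
    rw [hN', of_apply]
    by_cases hiS : i ∈ S
    · rw [if_pos hiS]
      exact hcolL i j hj
    · rw [if_neg hiS, hNo i (by rw [Finset.mem_union, not_or]; exact ⟨hi, hiS⟩) j, Matrix.one_apply,
        if_neg (fun h' : i = j => hi (h' ▸ hj))]
  have h4 := Matrix.twoBlockTriangular_det N' (fun i => i ∈ A) hN'tri
  have hblkA : N'.toSquareBlockProp (fun i => i ∈ A) = KA := by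
    ext a b
    rw [Matrix.toSquareBlockProp_def, of_apply, hN', of_apply, hKA, submatrix_apply,
      if_neg (fun h => Finset.disjoint_left.1 hAS a.2 h), hNA _ (Finset.mem_union_left S a.2)]
  -- the `σ × σ` matrix with the rows of `L` on `S` and unit rows elsewhere has the same `σ ∖ A` block
  set M₂ : Matrix σ σ R := Matrix.of (S.piecewise L.row (1 : Matrix σ σ R).row) with hM₂
  have hM₂det : M₂.det = (L.submatrix (Subtype.val : S → σ) (Subtype.val : S → σ)).det :=
    Matrix.det_piecewise_one_eq_submatrix_det L S
  have hM₂S : ∀ i ∈ S, ∀ j, M₂ i j = L i j := by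
    intro i hi j
    simp only [hM₂, of_apply, Finset.piecewise, Matrix.row]
    rw [if_pos hi]
  have hM₂o : ∀ i, i ∉ S → ∀ j, M₂ i j = (1 : Matrix σ σ R) i j := by
    intro i hi j
    simp only [hM₂, of_apply, Finset.piecewise, Matrix.row]
    rw [if_neg hi]
  have hM₂tri : ∀ i, ¬ i ∈ A → ∀ j, j ∈ A → M₂ i j = 0 := by
    intro i hi j hj
    by_cases hiS : i ∈ S
    · rw [hM₂S i hiS j]
      exact hcolL i j hj
    · rw [hM₂o i hiS j, Matrix.one_apply, if_neg (fun h' : i = j => hi (h' ▸ hj))]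
  have h5 := Matrix.twoBlockTriangular_det M₂ (fun i => i ∈ A) hM₂tri
  have hM₂A : M₂.toSquareBlockProp (fun i => i ∈ A) = 1 := by
    ext a b
    rw [Matrix.toSquareBlockProp_def, of_apply, hM₂o _ (fun h => Finset.disjoint_left.1 hAS a.2 h),
      Matrix.one_apply, Matrix.one_apply]
    by_cases hab : a = b
    · subst hab
      rw [if_pos rfl, if_pos rfl]
    · rw [if_neg (fun h => hab (Subtype.val_injective h)), if_neg hab]
  have hblk : N'.toSquareBlockProp (fun i => ¬ i ∈ A) = M₂.toSquareBlockProp (fun i => ¬ i ∈ A) := by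
    ext a b
    rw [Matrix.toSquareBlockProp_def, of_apply, Matrix.toSquareBlockProp_def, of_apply, hN', of_apply]
    by_cases haS : (a : σ) ∈ S
    · rw [if_pos haS, hM₂S _ haS]
    · rw [if_neg haS, hM₂o _ haS, hNo _ (by rw [Finset.mem_union, not_or]; exact ⟨a.2, haS⟩)]
  -- the `Fintype ↥A` instance produced by `twoBlockTriangular_det` (`Subtype.fintype`) is not the `Finset` one
  have hdetKA : @Matrix.det _ _ (Subtype.fintype fun i => i ∈ A) _ _ KA = KA.det := by
    rw [Subsingleton.elim (Subtype.fintype fun i => i ∈ A) (Finset.Subtype.fintype A)]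
  have hdet1 : @Matrix.det _ _ (Subtype.fintype fun i => i ∈ A) _ _
      (1 : Matrix {a // a ∈ A} {a // a ∈ A} R) = 1 :=
    @Matrix.det_one _ _ (Subtype.fintype fun i => i ∈ A) _ _
  -- assemble
  calc (K.submatrix (Subtype.val : ↥(A ∪ S) → σ) (Subtype.val : ↥(A ∪ S) → σ)).det = N.det := h1.symm
    _ = (E * N).det := by rw [det_mul, h2, one_mul]
    _ = N'.det := by rw [h3]
    _ = KA.det * (N'.toSquareBlockProp (fun i => ¬ i ∈ A)).det := by rw [h4, hblkA, hdetKA]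
    _ = KA.det * M₂.det := by rw [hblk, h5, hM₂A, hdet1, one_mul]
    _ = KA.det * (L.submatrix (Subtype.val : S → σ) (Subtype.val : S → σ)).det := by rw [hM₂det]

end Schur

/-! ## §3 Conditioning on `A ⊆ X`: Lyons Prop. 8.3 and the Palm kernels of Shirai–Takahashi -/

section CondIn

variable {μ : Finset σ → ℝ} {K : Matrix σ σ ℂ}

/-- **Conditioning on `A ⊆ X`** (Lyons Prop. 8.3 / (6.5) in matrix form, any kernel with `det K[A] ≠ 0`): the
conditional law `T ↦ 1_{A ⊆ T} μ(T) / P[A ⊆ X]` is determinantal with kernel `L + 1_A`,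
`L = K - K[·,A] K[A]⁻¹ K[A,·]` the Schur complement (the points of `A` are present a.s.; off `A` the kernel is
`L`, whose `(e, f)` entry is Lyons' `(P^⊥_{[A]_Q} e, P^⊥_{[A]_Q} f)_Q`). [cite: Lyons2003, §8 Prop. 8.3;
ShiraiTakahashi2003, Thm. 6.5] -/
theorem IsDeterminantal.condIn (h : IsDeterminantal μ K) (A : Finset σ)
    (hA : IsUnit (K.submatrix (Subtype.val : A → σ) (Subtype.val : A → σ)).det) :
    IsDeterminantal (fun T => (if A ⊆ T then μ T else 0) / ∑ U ∈ univ.filter (fun U => A ⊆ U), μ U)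
      (K - K.submatrix id (Subtype.val : A → σ) * (K.submatrix (Subtype.val : A → σ) (Subtype.val : A → σ))⁻¹ *
          K.submatrix (Subtype.val : A → σ) id + diagonal (fun i => if i ∈ A then (1 : ℂ) else 0)) := by
  set KA := K.submatrix (Subtype.val : A → σ) (Subtype.val : A → σ) with hKA
  set L := K - K.submatrix id (Subtype.val : A → σ) * KA⁻¹ * K.submatrix (Subtype.val : A → σ) id with hL
  have hrowL : ∀ i ∈ A, ∀ j, L i j = 0 := fun i hi j => schur_apply_eq_zero_of_mem_left K A hA hi j
  intro S
  have hd : ((∑ U ∈ univ.filter (fun U => A ⊆ U), μ U : ℝ) : ℂ) = KA.det := h A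
  have hnum : (∑ T ∈ univ.filter (fun T => S ⊆ T), (if A ⊆ T then μ T else 0)) =
      ∑ T ∈ univ.filter (fun T => A ∪ S \ A ⊆ T), μ T := by
    rw [Finset.sum_filter, Finset.sum_filter]
    refine Finset.sum_congr rfl fun T _ => ?_
    have hiff : A ∪ S \ A ⊆ T ↔ S ⊆ T ∧ A ⊆ T := by
      rw [Finset.union_sdiff_self_eq_union, Finset.union_subset_iff, and_comm]
    by_cases hAT : A ⊆ T
    · by_cases hS : S ⊆ T
      · rw [if_pos hS, if_pos hAT, if_pos (hiff.2 ⟨hS, hAT⟩)]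
      · rw [if_neg hS, if_neg (fun h' => hS (hiff.1 h').1)]
    · by_cases hS : S ⊆ T
      · rw [if_pos hS, if_neg hAT, if_neg (fun h' => hAT (hiff.1 h').2)]
      · rw [if_neg hS, if_neg (fun h' => hS (hiff.1 h').1)]
  show ((∑ T ∈ univ.filter (fun T => S ⊆ T),
    (if A ⊆ T then μ T else 0) / ∑ U ∈ univ.filter (fun U => A ⊆ U), μ U : ℝ) : ℂ) = _
  rw [← Finset.sum_div, hnum, Complex.ofReal_div, hd, h (A ∪ S \ A),
    det_submatrix_union_eq_mul_det_schur K A Finset.disjoint_sdiff hA, ← hKA, ← hL,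
    mul_div_cancel_left₀ _ hA.ne_zero, ← Matrix.det_piecewise_one_eq_submatrix_det L (S \ A),
    ← Matrix.det_piecewise_one_eq_submatrix_det (L + diagonal (fun i => if i ∈ A then (1 : ℂ) else 0)) S]
  congr 1
  ext i j
  simp only [of_apply, Finset.piecewise, Matrix.row, Finset.mem_sdiff]
  by_cases hiS : i ∈ S
  · by_cases hiA : i ∈ A
    · rw [if_neg (fun h' => h'.2 hiA), if_pos hiS, Matrix.add_apply, hrowL i hiA j, zero_add, diagonal_apply,
        Matrix.one_apply]
      by_cases hij : i = j
      · subst hij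
        rw [if_pos rfl, if_pos rfl, if_pos hiA]
      · rw [if_neg hij, if_neg hij]
    · rw [if_pos ⟨hiS, hiA⟩, if_pos hiS, Matrix.add_apply, diagonal_apply]
      by_cases hij : i = j
      · subst hij
        rw [if_pos rfl, if_neg hiA, add_zero]
      · rw [if_neg hij, add_zero]
  · rw [if_neg (fun h' => hiS h'.1), if_neg hiS]

/-- **Lyons, Proposition 8.3 verbatim**: conditioned on `A ⊆ X`, the law of `X ∩ (σ ∖ A)` (the tree's
`projectOn Aᶜ`) is determinantal with kernel the Schur complement `L = K - K[·,A] K[A]⁻¹ K[A,·]` (restricted to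
`σ ∖ A`; as a `σ × σ` matrix it vanishes on `A` anyway). [cite: Lyons2003, §8 Prop. 8.3] -/
theorem IsDeterminantal.projectOn_compl_condIn (h : IsDeterminantal μ K) (A : Finset σ)
    (hA : IsUnit (K.submatrix (Subtype.val : A → σ) (Subtype.val : A → σ)).det) :
    IsDeterminantal (projectOn Aᶜ (fun T => (if A ⊆ T then μ T else 0) / ∑ U ∈ univ.filter (fun U => A ⊆ U), μ U))
      (Matrix.of fun i j => if i ∈ A ∨ j ∈ A then 0 else
        (K - K.submatrix id (Subtype.val : A → σ) * (K.submatrix (Subtype.val : A → σ) (Subtype.val : A → σ))⁻¹ *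
          K.submatrix (Subtype.val : A → σ) id : Matrix σ σ ℂ) i j) := by
  have h1 := isDeterminantal_projectOn (h.condIn A hA) Aᶜ
  have hker : (Matrix.of fun i j => if i ∈ Aᶜ ∧ j ∈ Aᶜ then
      (K - K.submatrix id (Subtype.val : A → σ) * (K.submatrix (Subtype.val : A → σ) (Subtype.val : A → σ))⁻¹ *
        K.submatrix (Subtype.val : A → σ) id + diagonal (fun i => if i ∈ A then (1 : ℂ) else 0) :
          Matrix σ σ ℂ) i j else 0) =
      Matrix.of fun i j => if i ∈ A ∨ j ∈ A then 0 else
        (K - K.submatrix id (Subtype.val : A → σ) * (K.submatrix (Subtype.val : A → σ) (Subtype.val : A → σ))⁻¹ *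
          K.submatrix (Subtype.val : A → σ) id : Matrix σ σ ℂ) i j := by
    ext i j
    rw [of_apply, of_apply]
    by_cases hiA : i ∈ A
    · rw [if_neg (fun h' => Finset.mem_compl.1 h'.1 hiA), if_pos (Or.inl hiA)]
    · by_cases hjA : j ∈ A
      · rw [if_neg (fun h' => Finset.mem_compl.1 h'.2 hjA), if_pos (Or.inr hjA)]
      · rw [if_pos ⟨Finset.mem_compl.2 hiA, Finset.mem_compl.2 hjA⟩, if_neg (not_or.2 ⟨hiA, hjA⟩),
          Matrix.add_apply, diagonal_apply]
        by_cases hij : i = j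
        · subst hij
          rw [if_pos rfl, if_neg hiA, add_zero]
        · rw [if_neg hij, add_zero]
  rw [hker] at h1
  exact h1

/-- **Shirai–Takahashi, Theorem 6.5 (Palm kernel)**: conditioned on `x₀ ∈ X` (`K(x₀,x₀) ≠ 0`), the law
`T ↦ 1_{x₀ ∈ T} μ(T) / K(x₀, x₀)` is determinantal with kernel
`K^{x₀}(x, y) = K(x, y) - K(x, x₀) K(x₀, y) / K(x₀, x₀)` off `x₀` — the expansion of
"`(1/K(x₀,x₀)) det [K(x,y), K(x,x₀); K(x₀,y), K(x₀,x₀)]`" — completed by `1` at `(x₀, x₀)` (the point `x₀` itself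
is present a.s.; Shirai–Takahashi's Palm measure removes it, Remark 6.2). [cite: ShiraiTakahashi2003, Thm. 6.5
eq. (6.14); Lyons2003, Prop. 6.3 (first display) and Prop. 8.3] -/
theorem IsDeterminantal.palm (h : IsDeterminantal μ K) {e : σ} (he : K e e ≠ 0) :
    IsDeterminantal (fun T => (if e ∈ T then μ T else 0) / ∑ U ∈ univ.filter (fun U => e ∈ U), μ U)
      (Matrix.of fun i j => K i j - K i e * K e j / K e e + if i = e ∧ j = e then 1 else 0) := by
  have hsub : Subsingleton (↥({e} : Finset σ)) :=
    ⟨fun a b => Subtype.ext ((Finset.mem_singleton.1 a.2).trans (Finset.mem_singleton.1 b.2).symm)⟩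
  set e' : (↥({e} : Finset σ)) := ⟨e, Finset.mem_singleton_self e⟩ with he'
  have hKA : (K.submatrix (Subtype.val : (↥({e} : Finset σ)) → σ) (Subtype.val : (↥({e} : Finset σ)) → σ)) =
      Matrix.of (fun (_ : ↥({e} : Finset σ)) (_ : ↥({e} : Finset σ)) => K e e) := by
    ext a b
    rw [submatrix_apply, of_apply, Subsingleton.elim a e', Subsingleton.elim b e']
  have hA : IsUnit (K.submatrix (Subtype.val : (↥({e} : Finset σ)) → σ) (Subtype.val : (↥({e} : Finset σ)) → σ)).det := by
    rw [Matrix.det_eq_elem_of_card_eq_one (by simp) e', hKA, of_apply]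
    exact isUnit_iff_ne_zero.2 he
  have hinv : (K.submatrix (Subtype.val : (↥({e} : Finset σ)) → σ) (Subtype.val : (↥({e} : Finset σ)) → σ))⁻¹ =
      Matrix.of (fun (_ : ↥({e} : Finset σ)) (_ : ↥({e} : Finset σ)) => (K e e)⁻¹) := by
    apply Matrix.inv_eq_left_inv
    ext a b
    rw [Matrix.mul_apply, Fintype.sum_subsingleton _ a, hKA, of_apply, of_apply, inv_mul_cancel₀ he,
      Matrix.one_apply, if_pos (Subsingleton.elim a b)]
  have h1 := h.condIn {e} hA
  have hw : (fun T => (if ({e} : Finset σ) ⊆ T then μ T else 0) /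
      ∑ U ∈ univ.filter (fun U => ({e} : Finset σ) ⊆ U), μ U) =
      fun T => (if e ∈ T then μ T else 0) / ∑ U ∈ univ.filter (fun U => e ∈ U), μ U := by
    funext T
    simp only [Finset.singleton_subset_iff]
  have hker : (K - K.submatrix id (Subtype.val : (↥({e} : Finset σ)) → σ) *
        (K.submatrix (Subtype.val : (↥({e} : Finset σ)) → σ) (Subtype.val : (↥({e} : Finset σ)) → σ))⁻¹ *
        K.submatrix (Subtype.val : (↥({e} : Finset σ)) → σ) id +
        diagonal (fun i => if i ∈ ({e} : Finset σ) then (1 : ℂ) else 0)) =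
      Matrix.of fun i j => K i j - K i e * K e j / K e e + if i = e ∧ j = e then 1 else 0 := by
    ext i j
    rw [hinv, Matrix.add_apply, Matrix.sub_apply, of_apply, diagonal_apply, Matrix.mul_apply,
      Fintype.sum_subsingleton _ e', Matrix.mul_apply, Fintype.sum_subsingleton _ e']
    simp only [submatrix_apply, id_eq, of_apply, Finset.mem_singleton, he']
    have hite : (if i = j then (if i = e then (1 : ℂ) else 0) else 0) = if i = e ∧ j = e then 1 else 0 := by
      by_cases hij : i = j
      · subst hij
        by_cases hi : i = e
        · rw [if_pos rfl, if_pos hi, if_pos ⟨hi, hi⟩]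
        · rw [if_pos rfl, if_neg hi, if_neg (fun h' => hi h'.1)]
      · rw [if_neg hij, if_neg (fun h' => hij (h'.1.trans h'.2.symm))]
    rw [hite, div_eq_mul_inv]
    ring
  rw [hw, hker] at h1
  exact h1

end CondIn

/-! ## §4 Conditioning on `A ∩ X = ∅` (deletion) through the complementation principle -/

section CondOut

variable {μ : Finset σ → ℝ} {K : Matrix σ σ ℂ}

omit [DecidableEq σ] in
/-- `Σ_{U ⊇ A} μ(Uᶜ) = Σ_{U ∩ A = ∅} μ(U)`. [cite: Gorin2021, Lemma 18.1 (complementary configuration)] -/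
theorem sum_filter_subset_compl_eq [DecidableEq σ] (μ : Finset σ → ℝ) (A : Finset σ) :
    (∑ U ∈ univ.filter (fun U => A ⊆ U), μ Uᶜ) = ∑ U ∈ univ.filter (fun U => Disjoint A U), μ U := by
  refine Finset.sum_nbij' (fun T => Tᶜ) (fun U => Uᶜ) ?_ ?_ ?_ ?_ ?_
  · intro T hT
    simp only [Finset.mem_filter, Finset.mem_univ, true_and] at hT ⊢
    exact le_compl_iff_disjoint_right.1 (hT.trans (compl_compl T).symm.subset)
  · intro U hU
    simp only [Finset.mem_filter, Finset.mem_univ, true_and] at hU ⊢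
    exact le_compl_iff_disjoint_right.2 hU
  · intro T _
    exact compl_compl T
  · intro U _
    exact compl_compl U
  · intro T _
    rfl

/-- **Conditioning on `A ∩ X = ∅`**: if `det (I - K)[A] ≠ 0` (`= P[A ∩ X = ∅]`), the conditional law
`T ↦ 1_{A ∩ T = ∅} μ(T) / P[A ∩ X = ∅]` is determinantal with kernel `I - (I - K)^{A}`, where `M^{A}` denotes the
kernel `M - M[·,A] M[A]⁻¹ M[A,·] + 1_A` of §3 for `M = I - K` (the case `A ⊆ X` applied to the complementary
process, which has kernel `I - K`, and complemented back). [cite: Lyons2003, Prop. 6.3 (second display) with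
Cor. 5.3; BufetovQiuShamov2016, §2 (`χ_{B^c} K (1 - χ_B K)⁻¹ χ_{B^c}`); Gorin2021, Lemma 18.1] -/
theorem IsDeterminantal.condOut (h : IsDeterminantal μ K) (A : Finset σ)
    (hA : IsUnit ((1 - K).submatrix (Subtype.val : A → σ) (Subtype.val : A → σ)).det) :
    IsDeterminantal (fun T => (if Disjoint A T then μ T else 0) / ∑ U ∈ univ.filter (fun U => Disjoint A U), μ U)
      (1 - ((1 - K) - (1 - K).submatrix id (Subtype.val : A → σ) *
          ((1 - K).submatrix (Subtype.val : A → σ) (Subtype.val : A → σ))⁻¹ * (1 - K).submatrix (Subtype.val : A → σ) id +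
          diagonal (fun i => if i ∈ A then (1 : ℂ) else 0))) := by
  have h1 := (h.compl.condIn A hA).compl
  have hw : (fun T => (fun T => (if A ⊆ T then μ Tᶜ else 0) /
      ∑ U ∈ univ.filter (fun U => A ⊆ U), μ Uᶜ) Tᶜ) =
      fun T => (if Disjoint A T then μ T else 0) / ∑ U ∈ univ.filter (fun U => Disjoint A U), μ U := by
    funext T
    simp only [compl_compl, sum_filter_subset_compl_eq]
    by_cases hAT : Disjoint A T
    · rw [if_pos (le_compl_iff_disjoint_right.2 hAT), if_pos hAT]
    · rw [if_neg (fun h' => hAT (le_compl_iff_disjoint_right.1 h')), if_neg hAT]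
  rw [hw] at h1
  exact h1

omit [Fintype σ] in
/-- **The deletion kernel off `A`**: for `i, j ∉ A` the kernel of `IsDeterminantal.condOut` has entries
`K_ij + Σ_{a,b∈A} K_ia ((I - K)[A]⁻¹)_{ab} K_bj`, i.e. `K + K[·,A] (I - K[A])⁻¹ K[A,·]` — the discrete form of
`χ_{B^c} K (1 - χ_B K)⁻¹ χ_{B^c}`. [cite: BufetovQiuShamov2016, §2 (kernel of `P̄_K|_{Conf(B^c)}`, "in the
discrete setting, see also Borodin and Rains, Lyons"); Lyons2003, Prop. 6.3] -/
theorem condOut_kernel_apply (K : Matrix σ σ ℂ) (A : Finset σ) {i j : σ} (hi : i ∉ A) (hj : j ∉ A) :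
    (1 - ((1 - K) - (1 - K).submatrix id (Subtype.val : A → σ) *
          ((1 - K).submatrix (Subtype.val : A → σ) (Subtype.val : A → σ))⁻¹ * (1 - K).submatrix (Subtype.val : A → σ) id +
          diagonal (fun i => if i ∈ A then (1 : ℂ) else 0)) : Matrix σ σ ℂ) i j =
      K i j + (K.submatrix id (Subtype.val : A → σ) * ((1 - K).submatrix (Subtype.val : A → σ) (Subtype.val : A → σ))⁻¹ *
        K.submatrix (Subtype.val : A → σ) id : Matrix σ σ ℂ) i j := by
  set Mi := ((1 - K).submatrix (Subtype.val : A → σ) (Subtype.val : A → σ))⁻¹ with hMi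
  -- the border blocks of `I - K` off `A` are those of `-K`
  have hC : ∀ a : A, (1 - K).submatrix id (Subtype.val : A → σ) i a = -K i a := by
    intro a
    rw [submatrix_apply, id_eq, Matrix.sub_apply, Matrix.one_apply, if_neg (fun h' : i = (a : σ) => hi (h' ▸ a.2)),
      zero_sub]
  have hR : ∀ b : A, (1 - K).submatrix (Subtype.val : A → σ) id b j = -K b j := by
    intro b
    rw [submatrix_apply, id_eq, Matrix.sub_apply, Matrix.one_apply, if_neg (fun h' : (b : σ) = j => hj (h' ▸ b.2)),
      zero_sub]
  have hprod : ((1 - K).submatrix id (Subtype.val : A → σ) * Mi * (1 - K).submatrix (Subtype.val : A → σ) id) i j =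
      (K.submatrix id (Subtype.val : A → σ) * Mi * K.submatrix (Subtype.val : A → σ) id) i j := by
    rw [Matrix.mul_apply, Matrix.mul_apply]
    refine Finset.sum_congr rfl fun b _ => ?_
    rw [hR b, Matrix.mul_apply, Matrix.mul_apply, submatrix_apply, id_eq]
    rw [show (∑ a : A, (1 - K).submatrix id (Subtype.val : A → σ) i a * Mi a b) = -∑ a : A, K i a * Mi a b by
      rw [← Finset.sum_neg_distrib]
      exact Finset.sum_congr rfl fun a _ => by rw [hC a, neg_mul]]
    simp only [submatrix_apply, id_eq]
    ring
  rw [Matrix.sub_apply, Matrix.add_apply, Matrix.sub_apply, hprod, Matrix.sub_apply, Matrix.one_apply, diagonal_apply]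
  by_cases hij : i = j
  · subst hij
    rw [if_pos rfl, if_pos rfl, if_neg hi]
    ring
  · rw [if_neg hij, if_neg hij]
    ring

/-- **Lyons, Proposition 6.3 (second display), Palm version for absence**: conditioned on `x₀ ∉ X`
(`K(x₀,x₀) ≠ 1`), the law is determinantal with kernel `K(x,y) + K(x,x₀)K(x₀,y)/(1 - K(x₀,x₀))` off `x₀` and
`0` on the row and column of `x₀`. [cite: Lyons2003, Prop. 6.3; ShiraiTakahashi2003, Thm. 6.5 with
Lyons2003 Cor. 5.3 (duality)] -/
theorem IsDeterminantal.palm_out (h : IsDeterminantal μ K) {e : σ} (he : K e e ≠ 1) :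
    IsDeterminantal (fun T => (if e ∉ T then μ T else 0) / ∑ U ∈ univ.filter (fun U => e ∉ U), μ U)
      (Matrix.of fun i j => if i = e ∨ j = e then 0 else K i j + K i e * K e j / (1 - K e e)) := by
  have he' : (1 - K) e e ≠ 0 := by
    rw [Matrix.sub_apply, Matrix.one_apply_eq]
    exact sub_ne_zero.2 (Ne.symm he)
  have h1 := (h.compl.palm he').compl
  have hsum : (∑ U ∈ univ.filter (fun U => e ∈ U), μ Uᶜ) = ∑ U ∈ univ.filter (fun U => e ∉ U), μ U := by
    have h2 := sum_filter_subset_compl_eq μ {e}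
    simp only [Finset.singleton_subset_iff, Finset.disjoint_singleton_left] at h2
    exact h2
  have hw : (fun T => (fun T => (if e ∈ T then μ Tᶜ else 0) / ∑ U ∈ univ.filter (fun U => e ∈ U), μ Uᶜ) Tᶜ) =
      fun T => (if e ∉ T then μ T else 0) / ∑ U ∈ univ.filter (fun U => e ∉ U), μ U := by
    funext T
    simp only [compl_compl, hsum, Finset.mem_compl]
  have hker : (1 - (Matrix.of fun i j => (1 - K) i j - (1 - K) i e * (1 - K) e j / (1 - K) e e +
      if i = e ∧ j = e then 1 else 0)) =
      Matrix.of fun i j => if i = e ∨ j = e then 0 else K i j + K i e * K e j / (1 - K e e) := by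
    have h1K : (1 : ℂ) - K e e ≠ 0 := sub_ne_zero.2 (Ne.symm he)
    ext i j
    rw [Matrix.sub_apply, of_apply, of_apply]
    simp only [Matrix.sub_apply, Matrix.one_apply]
    by_cases hi : i = e
    · rw [hi]
      by_cases hj : j = e
      · rw [hj]
        simp only [if_true, and_self, or_self]
        field_simp
        ring
      · have hj' : ¬ e = j := fun h' => hj h'.symm
        simp only [if_true, hj, hj', if_false, and_false, true_or]
        field_simp
        ring
    · by_cases hj : j = e
      · rw [hj]
        simp only [if_true, hi, if_false, false_and, or_true]
        field_simp
        ring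
      · have hj' : ¬ e = j := fun h' => hj h'.symm
        simp only [if_true, hi, hj, hj', if_false, false_and, or_self]
        field_simp
        ring
  rw [hw, hker] at h1
  exact h1

end CondOut

end Literature.Probability.NegativeDependence

end
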